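import Summits.AnomalousDissipation.AnomalousDissipation.Theses.EnsembleRigidity
import Summits.AnomalousDissipation.AnomalousDissipation.Theorems.GPStatisticalRigidity.Negative.LoadBearing
import Summits.AnomalousDissipation.AnomalousDissipation.Theorems.GPStatisticalRigidity.Negative.IntegrableRedundant
import Literature.Analysis.FluidPDE.SteadyNavierStokesEnergy

/-!
# `EnsembleRigidity.GPStatisticalRigidity` (stmt-AnomalousDissipation-15508) in the tree's vocabulary:
# the crux forbids EVERY stationary statistical solution of Euler forced by `f_GP` — negative side

cdisprove seat `refuter-cdisprove-stmt-AnomalousDissipation-15508-0` (2026-08-16). The `R = 0` kill switch of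
`Negative/LoadBearing` rewritten on the tree's standard predicates (FMRT 2001, Ch. IV Def. 1.3 at `ν = 0`):

* `exactEulerStatistics_of_sss` — an `IsStationaryStatisticalSolution 0 f_GP μ` IS an exact statistics in the
  sense of the crux: its energy inequality at `ν = 0` is exactly the non-negative-shell-work clause, its generator
  identity is the vanishing cylindrical forced-Euler defect, and integrability of the energy is automatic
  (`integrable_norm_sq_of_ensembleEnstrophy_lt_top`, Poincaré);
* `not_gpStatisticalRigidity_of_eulerSSS` — hence ONE stationary statistical solution of forced Euler
  (`ν = 0`, force `f_GP`, any mean energy) refutes the crux: the crux CONTAINS the statement "`f_GP` carries no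
  FMRT stationary statistical solution of the forced Euler equations" (cf. `ForcedSmallScales` 1439/1440, where
  the Kolmogorov force DOES carry one);
* `not_gpStatisticalRigidity_of_steadyWeakEuler` — in particular ONE steady `H`-weak solution of forced Euler in
  `V = H ∩ H¹` (`Torus.IsSteadyWeakSolution 0 f_GP u`, FINITE ENSTROPHY ONLY — no smoothness) refutes it, by the
  tree fact `isStationaryStatisticalSolution_dirac_holds`: the exact-dodger kill needs `H¹`, not `C^∞`.
Nothing here asserts a Theses statement.
-/

noncomputable section

open MeasureTheory UnitAddTorus
open scoped InnerProductSpace ENNReal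

set_option linter.dupNamespace false

namespace Summit.AnomalousDissipation.AnomalousDissipation.Theorems.GPStatisticalRigidity.Negative

open Literature.Analysis.FunctionSpaces Literature.Analysis.FunctionSpaces.Torus Literature.Analysis.FluidPDE
open Summit.AnomalousDissipation.AnomalousDissipation.Theses.EnsembleRigidity

/-- A stationary statistical solution of FORCED EULER (`ν = 0`) is an exact statistics in the sense of the crux. -/
theorem exactEulerStatistics_of_sss {f : UnitAddTorus (Fin 3) → EuclideanSpace ℝ (Fin 3)}
    {μ : Measure (Torus.energySpace (Fin 3))} (hμ : Torus.IsStationaryStatisticalSolution 0 f μ) :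
    ExactEulerStatistics f μ := by
  haveI := hμ.prob
  have hG : Torus.ensembleEnstrophy μ < ⊤ := hμ.enstrophy_finite
  refine ⟨hμ.prob, integrable_norm_sq_of_ensembleEnstrophy_lt_top μ hG, hG, ?_, hμ.generator⟩
  intro e₁ e₂ h12
  have h := hμ.energy_ineq e₁ e₂ h12
  simp only [zero_mul, zero_sub, integral_neg, neg_nonpos] at h
  exact h

/-- **Kill switch (FMRT form).** ONE stationary statistical solution of the Euler equations forced by `f_GP`
(`ν = 0`; any mean energy) refutes the crux. -/
theorem not_gpStatisticalRigidity_of_eulerSSS {μ : Measure (Torus.energySpace (Fin 3))}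
    (hμ : Torus.IsStationaryStatisticalSolution 0 gpForce μ) : ¬ GPStatisticalRigidity :=
  not_gpStatisticalRigidity_of_exactEulerStatistics ⟨μ, exactEulerStatistics_of_sss hμ⟩

/-- `f_GP ∈ L²`. -/
theorem memLp_gpForce : MemLp gpForce 2 volume :=
  (Summit.AnomalousDissipation.AnomalousDissipation.Theorems.SteadyStatesLoudBounded.GpAdmissible.stub_gpAdmissible).1.memLp 2

/-- **Kill switch (finite-enstrophy dodger).** ONE steady `H`-weak solution of Euler forced by `f_GP` lying in
`V = H ∩ H¹` — an exact dodger of finite enstrophy, no smoothness required, any energy — refutes the crux. -/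
theorem not_gpStatisticalRigidity_of_steadyWeakEuler {u : Torus.energySpace (Fin 3)}
    (hV : ((u : Lp (EuclideanSpace ℝ (Fin 3)) 2 (volume : Measure (UnitAddTorus (Fin 3))))) ∈ Torus.energySpaceV (Fin 3))
    (hu : Torus.IsSteadyWeakSolution 0 gpForce u) : ¬ GPStatisticalRigidity :=
  not_gpStatisticalRigidity_of_eulerSSS
    (Torus.isStationaryStatisticalSolution_dirac_holds le_rfl memLp_gpForce (by simp) hV hu)

end Summit.AnomalousDissipation.AnomalousDissipation.Theorems.GPStatisticalRigidity.Negative
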